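import Summits.ValiantsHypothesis.ValiantsHypothesis.Theses.UlrichPadded
import Literature.Computability.AlgebraicComplexity.StandardFamiliesProofs
import Literature.Computability.AlgebraicComplexity.RankOneDeterminantalExpressionsProofs
import Literature.Computability.AlgebraicComplexity.PencilFamily
import Literature.Computability.AlgebraicComplexity.PermanentIrreducible
import Literature.Computability.AlgebraicComplexity.SymbolicMatrixDecomposition

/-!
# Disproof of `RankOneTrivialisation` (stmt-ValiantsHypothesis-5667) — findings

Work file of the standing crux disprover (cdisprove-5667; cycle 1 = sections 0, (a)–(c); cycle 2
(2026-08-16) = refactor of (a), sections (d), (e)); prose only in docstrings; the whole file is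
sorry-free (rc 0, axioms `propext, Classical.choice, Quot.sound`).

## Verdict (cycle 2): the crux RESISTS — it is a theorem of vzG + normality; NO dependence on 5666

Cycle 1 recorded the paper proof "5666 (Cl = 0) ⇒ graded kernel of `x₀A₀ + L` free ⇒ crux".  Cycle 2
(independently re-derived here, and by all three r1 triagers, TRIAGE-r1-{1,2,3}.md) sharpens it:
(i) by vzG's POINTWISE corank-one theorem (`vonzurGathen1987_perm_detRepr_rank_holds`, PROVED, every
point of `ℂ^{n²}`) the cofactors of `A` have no common zero, so `B := adj A mod per_n` is a rank-one
matrix over `S = ℂ[x]/(per_n)` with UNIT content and `K_A := Im B ≅ ker Ā` is an INVERTIBLE `S`-module;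
(ii) crux(A) ⇔ `[K_A] = 0 ∈ Pic(S)` EXACTLY (an outer product `c wᵀ` of unit content has unimodular
`c`, so `K_A = S·c`; conversely a generator gives `B = c wᵀ`) — and by section (d) below the degree
clause is automatic; (iii) `Pic(S) = 0` for the NORMAL graded domain `S` (Fossum Cor 10.3 + 18.3, held
text pp. 47/117; or Traverso–Swan + the Swan–Weibel weight homotopy), normality = R1 (vzG Lemma 2.3,
PROVED: `vonzurGathen1987_singPerm_height_holds`) + S2 (hypersurface).  So a counterexample would be an
affine representation of `per_n`, `n ≥ 3`, whose kernel line bundle is a non-trivial element of a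
trivial group: none exists.  Independently, crux 5666's picked line has 4/4 stubs landed (p71932,
p72089, p72386, p72455), after which `S` is a UFD and the cycle-1 proof applies verbatim.  What the
disprover CAN still do is map the edges — which is what sections (a)–(e) are:

## (a) Load-bearing hypotheses
* `3 ≤ n`: `rankOneTrivialisation_false_without_three_le` — at `n = 2` the crux fails for
  `A₂ = [[x₀₀, -x₀₁], [x₁₀, x₁₁]]`; cycle 2 UPGRADE `A₂_adjugate_not_outerProduct` /
  `rankOneTrivialisationDegreeFree_false_from_two`: `adj A₂` is not an outer product mod `per₂` AT ALL
  (no degree bound) — the kernel of `A₂` is the ruling of the quadric cone, `Cl = ℤ`, corank `2` at the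
  vertex, not invertible: exactly the vzG input (i) that fails at `n = 2`.
* affine entries: `rankOneTrivialisation_false_without_affine` — with only `det A = per_n` it fails for
  `N₃ = [[x₀₀, 1], [x₀₀k - per₃, k]]` (`n = 3`, `m = 2`).
  (LANDED, both: `Theorems/UlrichPaddedRankOneTrivialisationNegativeLoadBearing.lean`.)

## (b) Tightness and (c) the strengthening `dc + dw ≤ m - 2` (= former crux NoTightInfinity, `j ≥ 1`)
Section `Twisted`: the affine unimodular gauge `Bpp = (1 + D′)·gA·(1 + D)` of Grenet's `7 × 7` matrix
is a `7 × 7` affine representation of `per₃` whose linear part has corank ONE: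
`noTightInfinity_false` (5668 REFUTED and dropped from the route, Theorems/UlrichPaddedNoTightInfinity
Refutation.lean), `rankOneTrivialisation_tight_at_Bpp` (every factorisation of `adj Bpp` has
`deg c + deg w ≥ 6 = m - 1`), `rankOneTrivialisation_sharper_false` (`m - 2` is false),
`rankOneTrivialisation_grenetDegrees_false` (`deg c, deg w ≤ n - 1` is false).  Budget triples
`(exc_c, exc_w, j)`: Grenet `(0,0,2)`, `Bpp` `(1,1,0)`, one-sided twist `gA(1+D)` `(1,0,1)`, bordered
Grenet `(0,1,2)` at `m = 8` — only the sum `m + 1 - 2n` is gauge-invariant.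

## (d) NEW (cycle 2): the degree budget is NOT load-bearing — `rankOneTrivialisation_iff_degreeFree`
`RankOneTrivialisation ↔ RankOneTrivialisationDegreeFree` (the crux with `dc, dw` and all degree
clauses deleted).  Engine (GENERIC: any field, any `σ`, any homogeneous prime `f`):
`outerProduct_degree_trim` — if ANY `B` with `deg B_ij ≤ D` is `≡ c wᵀ (mod f)`, pass to minimal-degree
representatives; if `dc + dw > D` the top components multiply into the homogeneous PRIME ideal `(f)`, so
a whole vector of tops lies in `(f)`, contradicting minimality (`top_notMem_of_minimal`) unless that
vector is `≡ 0`, when `c = w = 0` works.  CONSEQUENCES for every seat: a would-be counterexample must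
fail to factor AT ALL (degrees never decide); the `m - 1` of the crux is BOTH sharp (b) and free (d); and
the two lines' degree-budget stubs are PROVED here with the skeletons' signatures verbatim —
`stub_degreeBudget_mod_homogeneous_prime` (`Lines/pic-not-cl.lean`) and `stub_gradedOuterProductBudget`
(`Lines/nagata-multilinear-chart.lean`, its hardest-by-cost stub): section `DegreeBudget` was
attached to the item as `DegreeBudgetStubs.lean` (01:22Z) and LANDED by a prover sixteen minutes later
as `Theorems/UlrichPaddedRankOneTrivialisationDegreeBudget.lean` (namespace
`Summit.ValiantsHypothesis.Theorems.RankOneTrivialisation`: `outerProduct_degree_trim`,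
`stub_degreeBudget_mod_homogeneous_prime`) — import that file rather than this section.  The `per_n`
specialisation and the degree-free `n = 2` edge are LANDED as
`Theorems/RankOneTrivialisation/Negative/DegreeFreeFalseFromTwo.lean` (p75824).

## (e) NEW (cycle 2): "unit cofactor" / "unimodular cofactor column" strengthenings are FALSE
Grenet's matrix has `(adj gA)_{ss} = 1` (`adjugate_gA_ss`; so does `Bpp`), which suggests normalising a
trivialisation by a unit cofactor, or taking the cyclic vector of card invertible-cokernel-pic to be a
coordinate vector `e_j` (= "column `j` of `adj A` is unimodular mod `per_n`").  Both are false already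
for the CONSTANT gauge `Bc = Pc·gA·Qc` (`Pc = 1 - E_{u₀s}`, `Qc = 1 - E_{sv₂}`, `det = 1`):
`not_unitCofactor`, `not_unimodularColumn`, `not_unimodularRow` — rows `s` / `u₀` (columns `s` / `v₂`)
of `Bc` vanish at the two points `0, p₁ ∈ V(per₃)`, so every column AND every row of `adj Bc` dies
somewhere on the hypersurface (`column_adjugate_Bc_vanishes`, `row_adjugate_Bc_vanishes`).  Lesson: vzG's unit content is a property of all `m²` cofactors
jointly; the sections `c, w` are genuinely non-constant in every entry in general; any stub of the form
"WLOG `c_s = 1`" is false, "WLOG after a constant gauge `c(0) = e_s`" is the correct normalisation.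
LANDED (column/unit-cofactor part): `Theorems/RankOneTrivialisation/Negative/UnitCofactorFalse.lean`
(p75521).

## Not formalised (paper-level, cycle 2)
* Entrywise-HOMOGENEOUS trivialisations do not always exist: the kernel generator of `Bpp` is
  `(1 - D)c_gA`, whose `u₀`-entry `P₀ - x₁₀P₂` (P_i = 2×2 subpermanents of columns 1,2) mixes degrees 2
  and 3, and the generator is unique up to `ℂˣ` and `(per₃)`-multiples (degree ≥ 3), so no choice is
  homogeneous.  (A Lean proof needs the uniqueness, i.e. the crux itself for `Bpp`; not attempted.)
* One-sided Grenet degrees (`deg c ≤ n - 1` with `w` free) fail at `Bpp` for the same reason (minimal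
  generator degrees `(3, 3)` are invariants of the representation, not of the chosen factorisation).
* char 2: over `𝔽₂`, `per₃ = det₃ = det X` and `adj X` is NOT an outer product mod `det₃` (Cl = ℤ·[ruling]):
  the crux is a statement about `ℂ` (char ≠ 2 enters through vzG), consistent with
  `Literature/Barriers/ValiantsHypothesis/PermanentCharTwo`.

## Attacks that found nothing (for the record)
symbolic/numeric (cycle 1): `det Bpp = per₃`, generic `rank L″ = 6`, `adj(L″(v₀)) = 4·(…)`; kit job
j004926 (kernel degrees for gA, Bpp, bordered gA) — settled by hand and in Lean.  Cycle 2: search for a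
junk reading of the Lean signature (`m = 0`: excluded by `det = per_n ≠ 1`; `m - 1` truncation: `m ≥ n`;
`totalDegree`/`Ideal.span` exact) — none; audit of the Pic-reduction (i)–(iii) against Fossum pp. 40/47/
117 and the tree's vzG theorems — no gap; the only formal (not mathematical) debts are Serre R1+S2 ⇒
normal and the Pic-form of Fossum 10.3 (or Traverso–Swan), cf. TRIAGE-r1-*.
-/

noncomputable section

set_option linter.dupNamespace false

namespace Summit.ValiantsHypothesis.ValiantsHypothesis.Cruxes.RankOneTrivialisation.Disproof

open MvPolynomial Matrix
open Literature.Computability.AlgebraicComplexity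
open Summit.ValiantsHypothesis.ValiantsHypothesis.Theses.UlrichPadded

/-! ## 0. Tools -/

/-- A multiple of `per_n` of total degree `< n` is zero (`per_n` is a nonzero form of degree `n` and
`ℂ[x]` is a domain). [folklore] -/
theorem eq_zero_of_mem_span_perPoly {n : ℕ} {q : MvPolynomial (Fin n × Fin n) ℂ}
    (hq : q ∈ Ideal.span {perPoly (Fin n) ℂ}) (hdeg : q.totalDegree < n) : q = 0 := by
  obtain ⟨k, rfl⟩ := Ideal.mem_span_singleton.1 hq
  by_contra hne
  have hk : k ≠ 0 := by
    rintro rfl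
    exact hne (mul_zero _)
  have hper : perPoly (Fin n) ℂ ≠ 0 := perPoly_ne_zero (Fin n) ℂ
  have hdegper : (perPoly (Fin n) ℂ).totalDegree = n := by
    simpa [Fintype.card_fin] using
      (perPoly_isHomogeneous (n := Fin n) (k := ℂ)).totalDegree hper
  rw [totalDegree_mul_of_isDomain hper hk, hdegper] at hdeg
  omega

/-- `1 ∉ (per_n)` for `n ≥ 1`. [folklore] -/
theorem one_notMem_span_perPoly {n : ℕ} (hn : 1 ≤ n) :
    (1 : MvPolynomial (Fin n × Fin n) ℂ) ∉ Ideal.span {perPoly (Fin n) ℂ} := fun h =>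
  one_ne_zero (eq_zero_of_mem_span_perPoly h (by rw [totalDegree_one]; omega))

/-- `X a ∉ (per_n)` for `n ≥ 2`. [folklore] -/
theorem X_notMem_span_perPoly {n : ℕ} (hn : 2 ≤ n) (a : Fin n × Fin n) :
    (X a : MvPolynomial (Fin n × Fin n) ℂ) ∉ Ideal.span {perPoly (Fin n) ℂ} := fun h =>
  X_ne_zero a (eq_zero_of_mem_span_perPoly h (by rw [totalDegree_X]; omega))

/-! ## (a) Load-bearing hypothesis `3 ≤ n`: the crux is FALSE at `n = 2` -/

/-- The crux with its side condition `3 ≤ n` weakened to `2 ≤ n` (everything else verbatim). -/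
def RankOneTrivialisationFromTwo : Prop :=
  ∀ n : ℕ, 2 ≤ n → ∀ (m : ℕ) (A : Matrix (Fin m) (Fin m) (MvPolynomial (Fin n × Fin n) ℂ)),
    IsAffineDetRepr (perPoly (Fin n) ℂ) A →
    ∃ (c w : Fin m → MvPolynomial (Fin n × Fin n) ℂ) (dc dw : ℕ), dc + dw ≤ m - 1 ∧
      (∀ i, (c i).totalDegree ≤ dc) ∧ (∀ i, (w i).totalDegree ≤ dw) ∧
      ∀ i j, A.adjugate i j - c i * w j ∈ Ideal.span {perPoly (Fin n) ℂ}

/-- Sanity: the weakened statement implies the crux, so its refutation says precisely that any proof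
of the crux must use `3 ≤ n`. [folklore] -/
theorem rankOneTrivialisation_of_fromTwo (h : RankOneTrivialisationFromTwo) :
    RankOneTrivialisation :=
  fun n hn => h n (by omega)

/-- The `2 × 2` witness `A₂ = [[x₀₀, -x₀₁], [x₁₀, x₁₁]]` with `det A₂ = per₂`. -/
def A₂ : Matrix (Fin 2) (Fin 2) (MvPolynomial (Fin 2 × Fin 2) ℂ) :=
  !![X (0, 0), -X (0, 1); X (1, 0), X (1, 1)]

/-- `per₂ = x₀₀x₁₁ + x₁₀x₀₁`. [folklore] -/
theorem perPoly_two_eq : perPoly (Fin 2) ℂ = X (0, 0) * X (1, 1) + X (1, 0) * X (0, 1) := by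
  simp [perPoly, permanent_fin_two, Matrix.mvPolynomialX_apply]

/-- `A₂` is an affine determinantal representation of `per₂`. [folklore] -/
theorem isAffineDetRepr_A₂ : IsAffineDetRepr (perPoly (Fin 2) ℂ) A₂ := by
  refine ⟨fun i j => ?_, ?_⟩
  · fin_cases i <;> fin_cases j <;> simp [A₂, totalDegree_X, totalDegree_neg]
  · rw [Matrix.det_fin_two, perPoly_two_eq]
    simp [A₂]
    ring

/-- The computation behind `rankOneTrivialisation_false_without_three_le`: `adj A₂ = [[x₁₁, x₀₁],
[-x₁₀, x₀₀]]` is not `≡ c wᵀ (mod per₂)` with `deg c + deg w ≤ 1` — one factor would be constant,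
forcing two linearly independent linear forms to be proportional modulo the quadric. (Section (d)
removes the degree bound: `A₂_adjugate_not_outerProduct`.) [folklore] -/
theorem A₂_no_bounded_factorisation (c w : Fin 2 → MvPolynomial (Fin 2 × Fin 2) ℂ) (dc dw : ℕ)
    (hsum : dc + dw ≤ 1) (hc : ∀ i, (c i).totalDegree ≤ dc) (hw : ∀ i, (w i).totalDegree ≤ dw)
    (hmem : ∀ i j, A₂.adjugate i j - c i * w j ∈ Ideal.span {perPoly (Fin 2) ℂ}) : False := by
  have hadj : A₂.adjugate = !![X (1, 1), X (0, 1); -X (1, 0), X (0, 0)] := by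
    rw [Matrix.adjugate_fin_two]
    simp [A₂]
  have low : ∀ q : MvPolynomial (Fin 2 × Fin 2) ℂ, q ∈ Ideal.span {perPoly (Fin 2) ℂ} →
      q.totalDegree < 2 → q = 0 := fun q hq hd => eq_zero_of_mem_span_perPoly hq hd
  have h00 := hmem 0 0
  have h10 := hmem 1 0
  have h01 := hmem 0 1
  simp only [hadj, Matrix.of_apply, Matrix.cons_val', Matrix.cons_val_zero, Matrix.cons_val_one,
    Matrix.empty_val', Matrix.cons_val_fin_one] at h00 h10 h01
  have hdeg1 : ∀ (a b : ℂ) (u v : Fin 2 × Fin 2),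
      (C b * X u + C a * X v : MvPolynomial (Fin 2 × Fin 2) ℂ).totalDegree < 2 := by
    intro a b u v
    refine lt_of_le_of_lt ((totalDegree_add _ _).trans (max_le ?_ ?_)) one_lt_two <;>
      exact (totalDegree_mul _ _).trans (by simp [totalDegree_X])
  rcases (show dc = 0 ∨ dw = 0 by omega) with hdc | hdw
  · -- `c` is a vector of constants
    subst hdc
    have hc0 : c 0 = C (coeff 0 (c 0)) := totalDegree_eq_zero_iff_eq_C.1 (Nat.le_zero.1 (hc 0))
    have hc1 : c 1 = C (coeff 0 (c 1)) := totalDegree_eq_zero_iff_eq_C.1 (Nat.le_zero.1 (hc 1))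
    set a := coeff 0 (c 0)
    set b := coeff 0 (c 1)
    have hq : (C b * X (1, 1) + C a * X (1, 0) : MvPolynomial (Fin 2 × Fin 2) ℂ) ∈
        Ideal.span {perPoly (Fin 2) ℂ} := by
      have := Ideal.sub_mem _ (Ideal.mul_mem_left _ (C b) h00) (Ideal.mul_mem_left _ (C a) h10)
      convert this using 1
      rw [hc0, hc1]
      ring
    have hq0 := low _ hq (hdeg1 a b _ _)
    have hb : b = 0 := by
      simpa using congr_arg (eval fun ij : Fin 2 × Fin 2 => if ij = (1, 1) then (1 : ℂ) else 0) hq0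
    have ha : a = 0 := by
      simpa using congr_arg (eval fun ij : Fin 2 × Fin 2 => if ij = (1, 0) then (1 : ℂ) else 0) hq0
    have hX : (X (1, 1) : MvPolynomial (Fin 2 × Fin 2) ℂ) ∈ Ideal.span {perPoly (Fin 2) ℂ} := by
      have := h00
      rw [hc0, ha] at this
      simpa using this
    exact X_notMem_span_perPoly le_rfl _ hX
  · -- `w` is a vector of constants
    subst hdw
    have hw0 : w 0 = C (coeff 0 (w 0)) := totalDegree_eq_zero_iff_eq_C.1 (Nat.le_zero.1 (hw 0))
    have hw1 : w 1 = C (coeff 0 (w 1)) := totalDegree_eq_zero_iff_eq_C.1 (Nat.le_zero.1 (hw 1))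
    set a := coeff 0 (w 0)
    set b := coeff 0 (w 1)
    have hq : (C b * X (1, 1) + C (-a) * X (0, 1) : MvPolynomial (Fin 2 × Fin 2) ℂ) ∈
        Ideal.span {perPoly (Fin 2) ℂ} := by
      have := Ideal.sub_mem _ (Ideal.mul_mem_left _ (C b) h00) (Ideal.mul_mem_left _ (C a) h01)
      convert this using 1
      rw [hw0, hw1, C_neg]
      ring
    have hq0 := low _ hq (hdeg1 (-a) b _ _)
    have hb : b = 0 := by
      simpa using congr_arg (eval fun ij : Fin 2 × Fin 2 => if ij = (1, 1) then (1 : ℂ) else 0) hq0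
    have ha : a = 0 := by
      simpa using congr_arg (eval fun ij : Fin 2 × Fin 2 => if ij = (0, 1) then (1 : ℂ) else 0) hq0
    have hX : (X (1, 1) : MvPolynomial (Fin 2 × Fin 2) ℂ) ∈ Ideal.span {perPoly (Fin 2) ℂ} := by
      have := h00
      rw [hw0, ha] at this
      simpa using this
    exact X_notMem_span_perPoly le_rfl _ hX

/-- **`3 ≤ n` is load-bearing**: at `n = 2` the quadric cone `ℂ[x]/(per₂)` is not factorial and the
kernel module of `A₂` is the non-trivial ruling (not even invertible at the vertex, where `A₂(0) = 0`
has corank `2`), so the crux with `2 ≤ n` fails at `A₂`. [folklore] -/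
theorem rankOneTrivialisation_false_without_three_le : ¬ RankOneTrivialisationFromTwo := by
  intro h
  obtain ⟨c, w, dc, dw, hsum, hc, hw, hmem⟩ := h 2 le_rfl 2 A₂ isAffineDetRepr_A₂
  exact A₂_no_bounded_factorisation c w dc dw hsum hc hw hmem

/-! ## (a') Load-bearing hypothesis "affine entries": FALSE for non-affine representations -/

/-- The crux with `IsAffineDetRepr` weakened to `det A = per_n` (entries of any degree). -/
def RankOneTrivialisationNonAffine : Prop :=
  ∀ n : ℕ, 3 ≤ n → ∀ (m : ℕ) (A : Matrix (Fin m) (Fin m) (MvPolynomial (Fin n × Fin n) ℂ)),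
    A.det = perPoly (Fin n) ℂ →
    ∃ (c w : Fin m → MvPolynomial (Fin n × Fin n) ℂ) (dc dw : ℕ), dc + dw ≤ m - 1 ∧
      (∀ i, (c i).totalDegree ≤ dc) ∧ (∀ i, (w i).totalDegree ≤ dw) ∧
      ∀ i j, A.adjugate i j - c i * w j ∈ Ideal.span {perPoly (Fin n) ℂ}

/-- Sanity: the weakened statement implies the crux. [folklore] -/
theorem rankOneTrivialisation_of_nonAffine (h : RankOneTrivialisationNonAffine) :
    RankOneTrivialisation :=
  fun n hn m A hA => h n hn m A hA.2

/-- `k = per` of the `(0,0)`-minor: `x₁₁x₂₂ + x₂₁x₁₂`. -/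
def k₃ : MvPolynomial (Fin 3 × Fin 3) ℂ := X (1, 1) * X (2, 2) + X (2, 1) * X (1, 2)

/-- The non-affine `2 × 2` witness `N₃ = [[x₀₀, 1], [x₀₀·k - per₃, k]]`, `det N₃ = per₃`. -/
def N₃ : Matrix (Fin 2) (Fin 2) (MvPolynomial (Fin 3 × Fin 3) ℂ) :=
  !![X (0, 0), 1; X (0, 0) * k₃ - perPoly (Fin 3) ℂ, k₃]

/-- `det N₃ = per₃`. [folklore] -/
theorem det_N₃ : N₃.det = perPoly (Fin 3) ℂ := by
  rw [Matrix.det_fin_two]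
  simp [N₃]

/-- **affineness is load-bearing**: for `N₃` (size `m = 2`, a cubic entry) `adj N₃ ≡ (1, -x₀₀)ᵀ(k, -1)`
needs `deg c + deg w = 3 > m - 1 = 1`; with `dc + dw ≤ 1` one factor is constant and either
`-1 ≡ 0` or `k ≡ const` modulo `per₃`. (The graded argument gives only `dc + dw ≤ d(m-1)` for entries of
degree `≤ d`.) [folklore] -/
theorem rankOneTrivialisation_false_without_affine : ¬ RankOneTrivialisationNonAffine := by
  intro h
  obtain ⟨c, w, dc, dw, hsum, hc, hw, hmem⟩ := h 3 le_rfl 2 N₃ det_N₃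
  have hadj : N₃.adjugate = !![k₃, -1; -(X (0, 0) * k₃ - perPoly (Fin 3) ℂ), X (0, 0)] := by
    rw [Matrix.adjugate_fin_two]
    simp [N₃]
  have low : ∀ q : MvPolynomial (Fin 3 × Fin 3) ℂ, q ∈ Ideal.span {perPoly (Fin 3) ℂ} →
      q.totalDegree < 3 → q = 0 := fun q hq hd => eq_zero_of_mem_span_perPoly hq hd
  have h00 := hmem 0 0
  have h01 := hmem 0 1
  have h11 := hmem 1 1
  simp only [hadj, Matrix.of_apply, Matrix.cons_val', Matrix.cons_val_zero, Matrix.cons_val_one,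
    Matrix.empty_val', Matrix.cons_val_fin_one] at h00 h01 h11
  have hk : k₃.totalDegree ≤ 2 := by
    refine (totalDegree_add _ _).trans (max_le ?_ ?_) <;>
      exact (totalDegree_mul _ _).trans (by simp [totalDegree_X])
  rcases (show dc = 0 ∨ dw = 0 by omega) with hdc | hdw
  · -- `c` constant: `-1 - a w₁ ∈ (per)`, `x₀₀ - b w₁ ∈ (per)` ⇒ `-b - a x₀₀ ∈ (per)` ⇒ `a = b = 0` ⇒ `-1 ∈ (per)`
    subst hdc
    have hc0 : c 0 = C (coeff 0 (c 0)) := totalDegree_eq_zero_iff_eq_C.1 (Nat.le_zero.1 (hc 0))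
    have hc1 : c 1 = C (coeff 0 (c 1)) := totalDegree_eq_zero_iff_eq_C.1 (Nat.le_zero.1 (hc 1))
    set a := coeff 0 (c 0)
    set b := coeff 0 (c 1)
    have hq : (C (-b) + C (-a) * X (0, 0) : MvPolynomial (Fin 3 × Fin 3) ℂ) ∈
        Ideal.span {perPoly (Fin 3) ℂ} := by
      have := Ideal.sub_mem _ (Ideal.mul_mem_left _ (C b) h01) (Ideal.mul_mem_left _ (C a) h11)
      convert this using 1
      rw [hc0, hc1, C_neg, C_neg]
      ring
    have hq0 := low _ hq (by
      refine lt_of_le_of_lt ((totalDegree_add _ _).trans (max_le ?_ ?_)) (by norm_num : 1 < 3)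
      · simp
      · exact (totalDegree_mul _ _).trans (by simp [totalDegree_X]))
    have hb : b = 0 := by
      simpa using congr_arg (eval fun _ : Fin 3 × Fin 3 => (0 : ℂ)) hq0
    have ha : a = 0 := by
      have := congr_arg (eval fun ij : Fin 3 × Fin 3 => if ij = (0, 0) then (1 : ℂ) else 0) hq0
      simpa [hb] using this
    have h1 : (1 : MvPolynomial (Fin 3 × Fin 3) ℂ) ∈ Ideal.span {perPoly (Fin 3) ℂ} := by
      have := (Ideal.neg_mem_iff _).2 h01
      rw [hc0, ha] at this
      simpa using this
    exact one_notMem_span_perPoly (by norm_num) h1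
  · -- `w` constant: `k - c₀ a ∈ (per)`, `-1 - c₀ b ∈ (per)` ⇒ `b k + a ∈ (per)` ⇒ `a = b = 0` ⇒ `-1 ∈ (per)`
    subst hdw
    have hw0 : w 0 = C (coeff 0 (w 0)) := totalDegree_eq_zero_iff_eq_C.1 (Nat.le_zero.1 (hw 0))
    have hw1 : w 1 = C (coeff 0 (w 1)) := totalDegree_eq_zero_iff_eq_C.1 (Nat.le_zero.1 (hw 1))
    set a := coeff 0 (w 0)
    set b := coeff 0 (w 1)
    have hq : (C b * k₃ + C a : MvPolynomial (Fin 3 × Fin 3) ℂ) ∈ Ideal.span {perPoly (Fin 3) ℂ} := by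
      have := Ideal.sub_mem _ (Ideal.mul_mem_left _ (C b) h00) (Ideal.mul_mem_left _ (C a) h01)
      convert this using 1
      rw [hw0, hw1]
      ring
    have hq0 := low _ hq (by
      refine lt_of_le_of_lt ((totalDegree_add _ _).trans (max_le ?_ (by simp))) (by norm_num : 2 < 3)
      exact (totalDegree_mul _ _).trans (by simpa using hk))
    have ha : a = 0 := by
      simpa [k₃] using congr_arg (eval fun _ : Fin 3 × Fin 3 => (0 : ℂ)) hq0
    have hb : b = 0 := by
      have := congr_arg (eval fun ij : Fin 3 × Fin 3 => if ij = (1, 1) ∨ ij = (2, 2) then (1 : ℂ) else 0) hq0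
      simpa [k₃, ha] using this
    have h1 : (1 : MvPolynomial (Fin 3 × Fin 3) ℂ) ∈ Ideal.span {perPoly (Fin 3) ℂ} := by
      have := (Ideal.neg_mem_iff _).2 h01
      rw [hw1, hb] at this
      simpa using this
    exact one_notMem_span_perPoly (by norm_num) h1


/-! ## (b)/(c) The twisted Grenet representation `Bpp`: the budget `dc + dw ≤ m - 1` is ATTAINED,
the natural strengthening `dc + dw ≤ m - 2` is false, and the former crux `NoTightInfinity` (`j ≥ 1`) is FALSE -/

section Twisted

/-- Grenet's `7 × 7` representation of `per₃` (tree convention of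
`GrenetRigidityOptimalUniqueRefutation.lean`; rows/columns `s, u₀, u₁, u₂, v₀, v₁, v₂`). -/
def gA : Matrix (Fin 7) (Fin 7) (MvPolynomial (Fin 3 × Fin 3) ℂ) :=
  !![0, X (0, 0), X (1, 0), X (2, 0), 0, 0, 0;
     0, 1, 0, 0, 0, X (2, 1), X (1, 1);
     0, 0, 1, 0, X (2, 1), 0, X (0, 1);
     0, 0, 0, 1, X (1, 1), X (0, 1), 0;
     X (0, 2), 0, 0, 0, 1, 0, 0;
     X (1, 2), 0, 0, 0, 0, 1, 0;
     X (2, 2), 0, 0, 0, 0, 0, 1]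

/-- **The witness** `Bpp = (1 + D′) · gA · (1 + D)`, where `D = x₁₀E_{u₀u₂} - x₀₀E_{u₁u₂}` is a column
operation by a right syzygy of `(x₀₀, x₁₀, x₂₀)` and `D′ = x₁₂E_{v₂v₀} - x₀₂E_{v₂v₁}` a row operation by
a left syzygy of `(x₀₂, x₁₂, x₂₂)ᵀ`: both unimodular and AFFINENESS-PRESERVING, so `Bpp = gA + D + D′` is
again a `7 × 7` affine determinantal representation of `per₃` — but its linear part has corank `1`
(Grenet's has corank `2`). -/
def Bpp : Matrix (Fin 7) (Fin 7) (MvPolynomial (Fin 3 × Fin 3) ℂ) :=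
  !![0, X (0, 0), X (1, 0), X (2, 0), 0, 0, 0;
     0, 1, 0, X (1, 0), 0, X (2, 1), X (1, 1);
     0, 0, 1, -X (0, 0), X (2, 1), 0, X (0, 1);
     0, 0, 0, 1, X (1, 1), X (0, 1), 0;
     X (0, 2), 0, 0, 0, 1, 0, 0;
     X (1, 2), 0, 0, 0, 0, 1, 0;
     X (2, 2), 0, 0, 0, X (1, 2), -X (0, 2), 1]

/-- The linear part `L″` of `Bpp` (generic corank `1`; kernel `(0, x₁₀, -x₀₀, 0, 0, 0, 0)`,
left kernel `(0, 0, 0, 0, x₁₂, -x₀₂, 0)`, `adj L″ = g·k·k′ᵀ` with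
`g = ±(x₀₂x₁₁ + x₀₁x₁₂)(x₁₀x₀₁ + x₀₀x₁₁)` NOT divisible by `per₃`). -/
def Lpp : Matrix (Fin 7) (Fin 7) (MvPolynomial (Fin 3 × Fin 3) ℂ) :=
  !![0, X (0, 0), X (1, 0), X (2, 0), 0, 0, 0;
     0, 0, 0, X (1, 0), 0, X (2, 1), X (1, 1);
     0, 0, 0, -X (0, 0), X (2, 1), 0, X (0, 1);
     0, 0, 0, 0, X (1, 1), X (0, 1), 0;
     X (0, 2), 0, 0, 0, 0, 0, 0;
     X (1, 2), 0, 0, 0, 0, 0, 0;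
     X (2, 2), 0, 0, 0, X (1, 2), -X (0, 2), 0]

/-- `1 - D′` (lower unitriangular). -/
def Dneg : Matrix (Fin 7) (Fin 7) (MvPolynomial (Fin 3 × Fin 3) ℂ) :=
  !![1, 0, 0, 0, 0, 0, 0;
     0, 1, 0, 0, 0, 0, 0;
     0, 0, 1, 0, 0, 0, 0;
     0, 0, 0, 1, 0, 0, 0;
     0, 0, 0, 0, 1, 0, 0;
     0, 0, 0, 0, 0, 1, 0;
     0, 0, 0, 0, -X (1, 2), X (0, 2), 1]

/-- `1 - D` (upper unitriangular). -/
def Eneg : Matrix (Fin 7) (Fin 7) (MvPolynomial (Fin 3 × Fin 3) ℂ) :=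
  !![1, 0, 0, 0, 0, 0, 0;
     0, 1, 0, -X (1, 0), 0, 0, 0;
     0, 0, 1, X (0, 0), 0, 0, 0;
     0, 0, 0, 1, 0, 0, 0;
     0, 0, 0, 0, 1, 0, 0;
     0, 0, 0, 0, 0, 1, 0;
     0, 0, 0, 0, 0, 0, 1]

/-- `G₁ = (1 - D′) · Bpp = gA + D`. -/
def G₁ : Matrix (Fin 7) (Fin 7) (MvPolynomial (Fin 3 × Fin 3) ℂ) :=
  !![0, X (0, 0), X (1, 0), X (2, 0), 0, 0, 0;
     0, 1, 0, X (1, 0), 0, X (2, 1), X (1, 1);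
     0, 0, 1, -X (0, 0), X (2, 1), 0, X (0, 1);
     0, 0, 0, 1, X (1, 1), X (0, 1), 0;
     X (0, 2), 0, 0, 0, 1, 0, 0;
     X (1, 2), 0, 0, 0, 0, 1, 0;
     X (2, 2), 0, 0, 0, 0, 0, 1]

/-- Unipotent column operations of `GrenetRigidityOptimalUniqueRefutation.lean`: `gA · E₁ = A₁`. -/
def E₁ : Matrix (Fin 7) (Fin 7) (MvPolynomial (Fin 3 × Fin 3) ℂ) :=
  !![1, 0, 0, 0, 0, 0, 0;
     0, 1, 0, 0, 0, -X (2, 1), -X (1, 1);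
     0, 0, 1, 0, -X (2, 1), 0, -X (0, 1);
     0, 0, 0, 1, -X (1, 1), -X (0, 1), 0;
     0, 0, 0, 0, 1, 0, 0;
     0, 0, 0, 0, 0, 1, 0;
     0, 0, 0, 0, 0, 0, 1]

/-- `A₁ · E₂ = T`. -/
def E₂ : Matrix (Fin 7) (Fin 7) (MvPolynomial (Fin 3 × Fin 3) ℂ) :=
  !![1, 0, 0, 0, 0, 0, 0;
     0, 1, 0, 0, 0, 0, 0;
     0, 0, 1, 0, 0, 0, 0;
     0, 0, 0, 1, 0, 0, 0;
     -X (0, 2), 0, 0, 0, 1, 0, 0;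
     -X (1, 2), 0, 0, 0, 0, 1, 0;
     -X (2, 2), 0, 0, 0, 0, 0, 1]

/-- `A₁ = gA · E₁`. -/
def A₁ : Matrix (Fin 7) (Fin 7) (MvPolynomial (Fin 3 × Fin 3) ℂ) :=
  !![0, X (0, 0), X (1, 0), X (2, 0), -(X (1, 0) * X (2, 1) + X (2, 0) * X (1, 1)),
       -(X (0, 0) * X (2, 1) + X (2, 0) * X (0, 1)), -(X (0, 0) * X (1, 1) + X (1, 0) * X (0, 1));
     0, 1, 0, 0, 0, 0, 0;
     0, 0, 1, 0, 0, 0, 0;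
     0, 0, 0, 1, 0, 0, 0;
     X (0, 2), 0, 0, 0, 1, 0, 0;
     X (1, 2), 0, 0, 0, 0, 1, 0;
     X (2, 2), 0, 0, 0, 0, 0, 1]

/-- `per₃` written out (column expansion). -/
def per₃ : MvPolynomial (Fin 3 × Fin 3) ℂ :=
  X (0, 0) * (X (1, 1) * X (2, 2) + X (2, 1) * X (1, 2)) + X (1, 0) * (X (0, 1) * X (2, 2) + X (2, 1) * X (0, 2))
    + X (2, 0) * (X (0, 1) * X (1, 2) + X (1, 1) * X (0, 2))

/-- Upper triangular with corner `per₃`: `T = gA · E₁ · E₂`. -/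
def T : Matrix (Fin 7) (Fin 7) (MvPolynomial (Fin 3 × Fin 3) ℂ) :=
  !![per₃, X (0, 0), X (1, 0), X (2, 0), -(X (1, 0) * X (2, 1) + X (2, 0) * X (1, 1)),
       -(X (0, 0) * X (2, 1) + X (2, 0) * X (0, 1)), -(X (0, 0) * X (1, 1) + X (1, 0) * X (0, 1));
     0, 1, 0, 0, 0, 0, 0;
     0, 0, 1, 0, 0, 0, 0;
     0, 0, 0, 1, 0, 0, 0;
     0, 0, 0, 0, 1, 0, 0;
     0, 0, 0, 0, 0, 1, 0;
     0, 0, 0, 0, 0, 0, 1]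

theorem perPoly_three_eq : perPoly (Fin 3) ℂ = per₃ := by
  rw [perPoly, permanent_fin_three]
  simp only [Matrix.mvPolynomialX_apply, per₃]

theorem Dneg_mul_Bpp : Dneg * Bpp = G₁ := by
  refine Matrix.ext fun i j => ?_
  fin_cases i <;> fin_cases j <;> simp [Dneg, Bpp, G₁, Matrix.mul_apply, Fin.sum_univ_seven]
  all_goals ring

theorem G₁_mul_Eneg : G₁ * Eneg = gA := by
  refine Matrix.ext fun i j => ?_
  fin_cases i <;> fin_cases j <;> simp [G₁, Eneg, gA, Matrix.mul_apply, Fin.sum_univ_seven]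
  all_goals ring

theorem gA_mul_E₁ : gA * E₁ = A₁ := by
  refine Matrix.ext fun i j => ?_
  fin_cases i <;> fin_cases j <;> simp [gA, E₁, A₁, Matrix.mul_apply, Fin.sum_univ_seven]
  all_goals ring

theorem A₁_mul_E₂ : A₁ * E₂ = T := by
  refine Matrix.ext fun i j => ?_
  fin_cases i <;> fin_cases j <;> simp [A₁, E₂, T, per₃, Matrix.mul_apply, Fin.sum_univ_seven]
  all_goals ring

theorem det_Dneg : Dneg.det = 1 := by
  rw [Matrix.det_of_lowerTriangular Dneg (by
    intro i j hij; fin_cases i <;> fin_cases j <;> first | exact absurd hij (by decide) | simp [Dneg]),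
    Fin.prod_univ_seven]
  simp [Dneg]

theorem det_Eneg : Eneg.det = 1 := by
  rw [Matrix.det_of_upperTriangular (M := Eneg) (by
    intro i j hij; fin_cases i <;> fin_cases j <;> first | exact absurd hij (by decide) | simp [Eneg]),
    Fin.prod_univ_seven]
  simp [Eneg]

theorem det_E₁ : E₁.det = 1 := by
  rw [Matrix.det_of_upperTriangular (M := E₁) (by
    intro i j hij; fin_cases i <;> fin_cases j <;> first | exact absurd hij (by decide) | simp [E₁]),
    Fin.prod_univ_seven]
  simp [E₁]

theorem det_E₂ : E₂.det = 1 := by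
  rw [Matrix.det_of_lowerTriangular E₂ (by
    intro i j hij; fin_cases i <;> fin_cases j <;> first | exact absurd hij (by decide) | simp [E₂]),
    Fin.prod_univ_seven]
  simp [E₂]

theorem det_T : T.det = perPoly (Fin 3) ℂ := by
  rw [Matrix.det_of_upperTriangular (M := T) (by
    intro i j hij; fin_cases i <;> fin_cases j <;> first | exact absurd hij (by decide) | simp [T]),
    Fin.prod_univ_seven, perPoly_three_eq]
  simp [T]

theorem det_gA : gA.det = perPoly (Fin 3) ℂ := by
  have h := congrArg Matrix.det A₁_mul_E₂
  rwa [← gA_mul_E₁, Matrix.det_mul, Matrix.det_mul, det_E₁, det_E₂, det_T, mul_one, mul_one] at h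

theorem det_Bpp : Bpp.det = perPoly (Fin 3) ℂ := by
  have h := congrArg Matrix.det G₁_mul_Eneg
  rw [← Dneg_mul_Bpp, Matrix.det_mul, Matrix.det_mul, det_Dneg, det_Eneg, det_gA, one_mul,
    mul_one] at h
  exact h

/-- `Bpp` is an affine determinantal representation of `per₃` of size `7 = dc(per₃)`. [folklore] -/
theorem isAffineDetRepr_Bpp : IsAffineDetRepr (perPoly (Fin 3) ℂ) Bpp := by
  refine ⟨fun i j => ?_, det_Bpp⟩
  fin_cases i <;> fin_cases j <;> simp [Bpp, totalDegree_X, totalDegree_neg]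

theorem homogeneousComponent_one_X (a : Fin 3 × Fin 3) :
    homogeneousComponent 1 (X a : MvPolynomial (Fin 3 × Fin 3) ℂ) = X a := by
  rw [homogeneousComponent_of_mem ((mem_homogeneousSubmodule _ _).2 (isHomogeneous_X ℂ a))]
  simp

theorem homogeneousComponent_one_one :
    homogeneousComponent 1 (1 : MvPolynomial (Fin 3 × Fin 3) ℂ) = 0 := by
  rw [homogeneousComponent_of_mem ((mem_homogeneousSubmodule _ _).2 (isHomogeneous_one _ _))]
  simp

/-- The linear part of `Bpp` (degree-one homogeneous components, as the former NoTightInfinity forms it) is `Lpp`. [folklore] -/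
theorem Bpp_linearPart : (Matrix.of fun a b => homogeneousComponent 1 (Bpp a b)) = Lpp := by
  refine Matrix.ext fun a b => ?_
  fin_cases a <;> fin_cases b <;>
    simp [Bpp, Lpp, homogeneousComponent_one_X, homogeneousComponent_one_one]

/-- The evaluation point `v₀`: rows `0, 1` all ones, row `2` zero — a (singular) point of `V(per₃)`. -/
def v₀ : Fin 3 × Fin 3 → ℂ := fun rc => if rc.1 = 2 then 0 else 1

theorem eval_v₀_perPoly : eval v₀ (perPoly (Fin 3) ℂ) = 0 := by
  rw [perPoly_three_eq]
  simp [per₃, v₀]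

/-- `Lpp(v₀)`. -/
def N₀ : Matrix (Fin 7) (Fin 7) ℂ :=
  !![0, 1, 1, 0, 0, 0, 0;
     0, 0, 0, 1, 0, 0, 1;
     0, 0, 0, -1, 0, 0, 1;
     0, 0, 0, 0, 1, 1, 0;
     1, 0, 0, 0, 0, 0, 0;
     1, 0, 0, 0, 0, 0, 0;
     0, 0, 0, 0, 1, -1, 0]

theorem Lpp_map_eval : Lpp.map (eval v₀) = N₀ := by
  refine Matrix.ext fun a b => ?_
  fin_cases a <;> fin_cases b <;> simp [Lpp, N₀, v₀]

/-- `N₀` with row `v₀ = 4` replaced by `e_{u₀} = e₁`; its determinant is the cofactor `adj N₀ u₀ v₀ = 4`. -/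
def R₀ : Matrix (Fin 7) (Fin 7) ℂ :=
  !![0, 1, 1, 0, 0, 0, 0;
     0, 0, 0, 1, 0, 0, 1;
     0, 0, 0, -1, 0, 0, 1;
     0, 0, 0, 0, 1, 1, 0;
     0, 1, 0, 0, 0, 0, 0;
     1, 0, 0, 0, 0, 0, 0;
     0, 0, 0, 0, 1, -1, 0]

/-- An explicit inverse of `R₀` (so `det R₀ ≠ 0`). -/
def W₀ : Matrix (Fin 7) (Fin 7) ℂ :=
  !![0, 0, 0, 0, 0, 1, 0;
     0, 0, 0, 0, 1, 0, 0;
     1, 0, 0, 0, -1, 0, 0;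
     0, 1/2, -1/2, 0, 0, 0, 0;
     0, 0, 0, 1/2, 0, 0, 1/2;
     0, 0, 0, 1/2, 0, 0, -1/2;
     0, 1/2, 1/2, 0, 0, 0, 0]

theorem N₀_updateRow : N₀.updateRow 4 (Pi.single 1 1) = R₀ := by
  refine Matrix.ext fun a b => ?_
  fin_cases a <;> fin_cases b <;> simp [N₀, R₀, Matrix.updateRow_apply]

theorem R₀_mul_W₀ : R₀ * W₀ = 1 := by
  refine Matrix.ext fun a b => ?_
  fin_cases a <;> fin_cases b <;>
    simp [R₀, W₀, Matrix.mul_apply, Fin.sum_univ_seven] <;> norm_num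

theorem adjugate_N₀_ne_zero : N₀.adjugate 1 4 ≠ 0 := by
  rw [Matrix.adjugate_apply, N₀_updateRow]
  exact (Matrix.isUnit_det_of_right_inverse R₀_mul_W₀).ne_zero

/-- **Key fact (`j = 0` for `Bpp`).** The cofactor `adj(L″)_{u₀ v₀}` of the linear part of `Bpp` is NOT
divisible by `per₃`: it evaluates to `4` at the point `v₀ ∈ V(per₃)`. [folklore] -/
theorem adjugate_Lpp_notMem : Lpp.adjugate 1 4 ∉ Ideal.span {perPoly (Fin 3) ℂ} := by
  intro hmem
  obtain ⟨q, hq⟩ := Ideal.mem_span_singleton.1 hmem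
  have h0 : eval v₀ (Lpp.adjugate 1 4) = 0 := by
    rw [hq, map_mul, eval_v₀_perPoly, zero_mul]
  have h1 : eval v₀ (Lpp.adjugate 1 4) = N₀.adjugate 1 4 := by
    have h := RingHom.map_adjugate (eval v₀) Lpp
    rw [RingHom.mapMatrix_apply, RingHom.mapMatrix_apply, Lpp_map_eval] at h
    simpa [Matrix.map_apply] using congr_fun (congr_fun h 1) 4
  exact adjugate_N₀_ne_zero (h1 ▸ h0)

/-- **Refutation of the natural strengthening `j ≥ 1` = the FORMER crux `NoTightInfinity`
(stmt-ValiantsHypothesis-5668, dropped from the route on 2026-08-15 after its refutation; its statement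
is reproduced inline).** For the affine representation `Bpp` of `per₃` the submaximal minor
`adj(L″)_{u₀ v₀}` of its LINEAR PART is not divisible by `per₃`; equivalently the padded linear matrix
`x₀A₀ + L″` has corank exactly `1` at the generic point at infinity, the kernel generators have degrees
`(3, 3)` and the budget of `Bpp` is `7 = 5 + 1 + 1 + 0` (`j = 0`, tight at infinity).  Grenet's own
matrix has `j = 2`; the affine unimodular gauge `(1 + D′)·gA·(1 + D)` trades `j` for `exc_c + exc_w`.
[folklore] -/
theorem noTightInfinity_false :
    ¬ ∀ n : ℕ, 3 ≤ n → ∀ (m : ℕ) (A : Matrix (Fin m) (Fin m) (MvPolynomial (Fin n × Fin n) ℂ)),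
      IsAffineDetRepr (perPoly (Fin n) ℂ) A → ∀ i j,
        (Matrix.of fun a b => homogeneousComponent 1 (A a b)).adjugate i j ∈
          Ideal.span {perPoly (Fin n) ℂ} := by
  intro h
  have hmem := h 3 le_rfl 7 Bpp isAffineDetRepr_Bpp 1 4
  rw [Bpp_linearPart] at hmem
  exact adjugate_Lpp_notMem hmem

/-- Top homogeneous component of a cofactor of an affine matrix = the cofactor of its linear part
(Laplace along the deleted row/column + `homogeneousComponent_card_det_of_totalDegree_le_one`).
[folklore] -/
theorem homogeneousComponent_adjugate_of_totalDegree_le_one {σ : Type*} {m : ℕ}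
    (A : Matrix (Fin (m + 1)) (Fin (m + 1)) (MvPolynomial σ ℂ)) (hA : ∀ i j, (A i j).totalDegree ≤ 1)
    (i j : Fin (m + 1)) :
    homogeneousComponent m (A.adjugate i j) =
      (Matrix.of fun a b => homogeneousComponent 1 (A a b)).adjugate i j := by
  rw [Matrix.adjugate_fin_succ_eq_det_submatrix, Matrix.adjugate_fin_succ_eq_det_submatrix]
  have hsub : ∀ a b, (A.submatrix j.succAbove i.succAbove a b).totalDegree ≤ 1 := fun a b => hA _ _
  have h := homogeneousComponent_card_det_of_totalDegree_le_one (A.submatrix j.succAbove i.succAbove) hsub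
  rw [Fintype.card_fin] at h
  rw [show ((-1 : MvPolynomial σ ℂ) ^ ((j : ℕ) + i)) = C ((-1) ^ ((j : ℕ) + i)) by simp,
    homogeneousComponent_C_mul, h]
  rfl

/-- **Tightness of the crux's degree budget at `Bpp`.** Every `(c, w)` with `adj Bpp ≡ c wᵀ (mod per₃)`
has `deg c + deg w ≥ 6 = m - 1`: otherwise the degree-`6` component of `adj(Bpp)_{u₀v₀} - c_{u₀}w_{v₀}`,
which is `adj(L″)_{u₀v₀}`, would lie in the homogeneous ideal `(per₃)`. [folklore] -/
theorem rankOneTrivialisation_tight_at_Bpp (c w : Fin 7 → MvPolynomial (Fin 3 × Fin 3) ℂ) (dc dw : ℕ)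
    (hc : ∀ i, (c i).totalDegree ≤ dc) (hw : ∀ i, (w i).totalDegree ≤ dw)
    (hmem : ∀ i j, Bpp.adjugate i j - c i * w j ∈ Ideal.span {perPoly (Fin 3) ℂ}) : 6 ≤ dc + dw := by
  by_contra hlt
  rw [not_le] at hlt
  obtain ⟨q, hq⟩ := Ideal.mem_span_singleton.1 (hmem 1 4)
  have hcw : homogeneousComponent 6 (c 1 * w 4) = 0 :=
    homogeneousComponent_eq_zero _ _
      (lt_of_le_of_lt ((totalDegree_mul _ _).trans (add_le_add (hc 1) (hw 4))) hlt)
  have htop : homogeneousComponent 6 (Bpp.adjugate 1 4) = Lpp.adjugate 1 4 := by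
    rw [homogeneousComponent_adjugate_of_totalDegree_le_one Bpp isAffineDetRepr_Bpp.1, Bpp_linearPart]
  have hper : (perPoly (Fin 3) ℂ).IsHomogeneous 3 := by
    simpa using perPoly_isHomogeneous (n := Fin 3) (k := ℂ)
  have hmul : homogeneousComponent 6 (perPoly (Fin 3) ℂ * q) =
      perPoly (Fin 3) ℂ * homogeneousComponent 3 q :=
    homogeneousComponent_mul_of_isHomogeneous hper q 3
  have h6 := congrArg (homogeneousComponent 6) hq
  rw [map_sub, hcw, sub_zero, htop, hmul] at h6
  exact adjugate_Lpp_notMem (Ideal.mem_span_singleton.2 ⟨_, h6⟩)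

/-- The natural strengthening of the crux with budget `m - 2` in place of `m - 1`
(it would have followed from the former crux NoTightInfinity via the budget identity). -/
def RankOneTrivialisationSharper : Prop :=
  ∀ n : ℕ, 3 ≤ n → ∀ (m : ℕ) (A : Matrix (Fin m) (Fin m) (MvPolynomial (Fin n × Fin n) ℂ)),
    IsAffineDetRepr (perPoly (Fin n) ℂ) A →
    ∃ (c w : Fin m → MvPolynomial (Fin n × Fin n) ℂ) (dc dw : ℕ), dc + dw ≤ m - 2 ∧
      (∀ i, (c i).totalDegree ≤ dc) ∧ (∀ i, (w i).totalDegree ≤ dw) ∧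
      ∀ i j, A.adjugate i j - c i * w j ∈ Ideal.span {perPoly (Fin n) ℂ}

/-- Sanity: the strengthening implies the crux. [folklore] -/
theorem rankOneTrivialisation_of_sharper (h : RankOneTrivialisationSharper) : RankOneTrivialisation := by
  intro n hn m A hA
  obtain ⟨c, w, dc, dw, hsum, hc, hw, hmem⟩ := h n hn m A hA
  exact ⟨c, w, dc, dw, by omega, hc, hw, hmem⟩

/-- **The bound `m - 1` of the crux cannot be improved**: the strengthening with `m - 2` fails at
`Bpp` (`n = 3`, `m = 7`, minimal `dc + dw = 6`). [folklore] -/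
theorem rankOneTrivialisation_sharper_false : ¬ RankOneTrivialisationSharper := by
  intro h
  obtain ⟨c, w, dc, dw, hsum, hc, hw, hmem⟩ := h 3 le_rfl 7 Bpp isAffineDetRepr_Bpp
  have := rankOneTrivialisation_tight_at_Bpp c w dc dw hc hw hmem
  omega

/-- The strengthening "Grenet's degrees always suffice" (`deg c, deg w ≤ n - 1`, i.e.
`exc_c = exc_w = 0` for every representation — true for Grenet's matrices, `(exc_c, exc_w, j) =
(0, 0, 2ⁿ - 2n)`). -/
def RankOneTrivialisationGrenetDegrees : Prop :=
  ∀ n : ℕ, 3 ≤ n → ∀ (m : ℕ) (A : Matrix (Fin m) (Fin m) (MvPolynomial (Fin n × Fin n) ℂ)),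
    IsAffineDetRepr (perPoly (Fin n) ℂ) A →
    ∃ (c w : Fin m → MvPolynomial (Fin n × Fin n) ℂ),
      (∀ i, (c i).totalDegree ≤ n - 1) ∧ (∀ i, (w i).totalDegree ≤ n - 1) ∧
      ∀ i j, A.adjugate i j - c i * w j ∈ Ideal.span {perPoly (Fin n) ℂ}

/-- **`exc_c = exc_w = 0` is not always possible**: at `Bpp` the kernel generators have degree `3 = n`,
so no factorisation with `deg c, deg w ≤ n - 1 = 2` exists (`2 + 2 < 6`). [folklore] -/
theorem rankOneTrivialisation_grenetDegrees_false : ¬ RankOneTrivialisationGrenetDegrees := by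
  intro h
  obtain ⟨c, w, hc, hw, hmem⟩ := h 3 le_rfl 7 Bpp isAffineDetRepr_Bpp
  have := rankOneTrivialisation_tight_at_Bpp c w 2 2 hc hw hmem
  omega

end Twisted

/-! ## (d) The degree budget `dc + dw ≤ m - 1` is NOT load-bearing: it is automatic

Generic engine (any field `K`, any index type `σ`, any homogeneous PRIME form `f`), written so that the
two lines' degree-budget stubs are literally instances: `stub_degreeBudget_mod_homogeneous_prime`
(`Lines/pic-not-cl.lean`) and `stub_gradedOuterProductBudget` (`Lines/nagata-multilinear-chart.lean`,
marked hardest-by-cost) are PROVED at the end of this section with the skeletons' signatures verbatim —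
leads may copy the section body (it needs only Mathlib + `SymbolicMatrixDecomposition`). -/

section DegreeBudget

variable {K : Type*} [Field K] {σ : Type*}

/-- Homogeneous components of a multiple of a form are multiples of that form. [folklore] -/
theorem homogeneousComponent_mul_mem_span {φ : MvPolynomial σ K} {k : ℕ}
    (hφ : φ.IsHomogeneous k) (ψ : MvPolynomial σ K) (d : ℕ) :
    homogeneousComponent d (φ * ψ) ∈ Ideal.span {φ} := by
  have hψ : φ * ψ = ∑ j ∈ Finset.range (ψ.totalDegree + 1), φ * homogeneousComponent j ψ := by
    rw [← Finset.mul_sum, sum_homogeneousComponent]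
  rw [hψ, map_sum]
  refine Ideal.sum_mem _ fun j _ => ?_
  rw [homogeneousComponent_of_mem ((mem_homogeneousSubmodule _ _).2
    (hφ.mul (homogeneousComponent_isHomogeneous j ψ)))]
  split_ifs
  · exact Ideal.mul_mem_right _ _ (Ideal.subset_span rfl)
  · exact Ideal.zero_mem _

/-- The principal ideal of a form is homogeneous: it contains the components of its elements.
[folklore] -/
theorem homogeneousComponent_mem_span {f : MvPolynomial σ K} {e : ℕ} (hf : f.IsHomogeneous e)
    {g : MvPolynomial σ K} (hg : g ∈ Ideal.span {f}) (d : ℕ) :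
    homogeneousComponent d g ∈ Ideal.span {f} := by
  obtain ⟨q, rfl⟩ := Ideal.mem_span_singleton'.1 hg
  rw [mul_comm]
  exact homogeneousComponent_mul_mem_span hf q d

/-- Every residue class modulo an ideal has a representative of minimal total degree. [folklore] -/
theorem exists_minimal_rep (I : Ideal (MvPolynomial σ K)) (g : MvPolynomial σ K) :
    ∃ q : MvPolynomial σ K, g - q ∈ I ∧ ∀ q', q - q' ∈ I → q.totalDegree ≤ q'.totalDegree := by
  classical
  have hP : ∃ d, ∃ q, g - q ∈ I ∧ q.totalDegree ≤ d := ⟨_, g, by simp, le_rfl⟩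
  obtain ⟨q, hq, hqd⟩ := Nat.find_spec hP
  refine ⟨q, hq, fun q' hqq' => hqd.trans (Nat.find_min' hP ⟨q', ?_, le_rfl⟩)⟩
  have := I.add_mem hq hqq'
  rwa [sub_add_sub_cancel] at this

/-- A non-zero representative of minimal degree modulo a PRIME `f` has its top homogeneous component
outside `(f)` — otherwise subtracting it gives a representative of smaller degree (or, in degree `0`,
a non-zero constant in `(f)` would make `f` a unit). [folklore] -/
theorem top_notMem_of_minimal {f : MvPolynomial σ K} (hp : Prime f) {q : MvPolynomial σ K}
    (hmin : ∀ q', q - q' ∈ Ideal.span {f} → q.totalDegree ≤ q'.totalDegree) (hq0 : q ≠ 0) :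
    homogeneousComponent q.totalDegree q ∉ Ideal.span {f} := by
  intro htop
  by_cases hd : q.totalDegree = 0
  · rw [hd, homogeneousComponent_zero] at htop
    have ha : coeff 0 q ≠ 0 := by
      intro h0
      apply hq0
      rw [totalDegree_eq_zero_iff_eq_C.1 hd, h0, C_0]
    have hunit : IsUnit (C (coeff 0 q) : MvPolynomial σ K) := (isUnit_iff_ne_zero.2 ha).map C
    have htop' := Ideal.eq_top_of_isUnit_mem _ htop hunit
    exact hp.not_unit (Ideal.span_singleton_eq_top.1 htop')
  · set d := q.totalDegree with hd_def
    have hsum := sum_homogeneousComponent q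
    rw [Finset.sum_range_succ] at hsum
    rw [← hd_def] at hsum
    have hq' : q - ∑ i ∈ Finset.range d, homogeneousComponent i q = homogeneousComponent d q := by
      rw [sub_eq_iff_eq_add']
      exact hsum.symm
    have hle := hmin (∑ i ∈ Finset.range d, homogeneousComponent i q) (by rw [hq']; exact htop)
    have hlt : (∑ i ∈ Finset.range d, homogeneousComponent i q).totalDegree < d := by
      refine lt_of_le_of_lt (totalDegree_finsetSum_le fun i hi => ?_) (Nat.sub_one_lt hd)
      refine (homogeneousComponent_isHomogeneous i q).totalDegree_le.trans ?_
      rw [Finset.mem_range] at hi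
      omega
    omega

/-- If all minimal representatives `q i` have their degree-`d` components in `(f)`, `deg (q i) ≤ d` for
all `i` and `= d` for some `i`, then all `q i ∈ (f)`. [folklore] -/
theorem all_mem_of_top_mem {f : MvPolynomial σ K} (hp : Prime f) {m : ℕ} {q : Fin m → MvPolynomial σ K}
    {d : ℕ} (hmin : ∀ i q', q i - q' ∈ Ideal.span {f} → (q i).totalDegree ≤ q'.totalDegree)
    (hdeg : ∀ i, (q i).totalDegree ≤ d) (hex : ∃ i, (q i).totalDegree = d)
    (htop : ∀ i, homogeneousComponent d (q i) ∈ Ideal.span {f}) :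
    ∀ i, q i ∈ Ideal.span {f} := by
  obtain ⟨i₀, hi₀⟩ := hex
  by_cases h0 : q i₀ = 0
  · have hd0 : d = 0 := by rw [← hi₀, h0, totalDegree_zero]
    subst hd0
    intro i
    have hqi : q i = C (coeff 0 (q i)) := totalDegree_eq_zero_iff_eq_C.1 (Nat.le_zero.1 (hdeg i))
    rw [hqi, ← homogeneousComponent_zero]
    exact htop i
  · exact absurd (hi₀ ▸ htop i₀) (top_notMem_of_minimal hp (hmin i₀) h0)

/-- **The engine.** Modulo a homogeneous prime form `f`, an outer-product factorisation of a matrix `B`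
with `deg B_ij ≤ D` can be re-chosen with `deg c + deg w ≤ D`. [folklore] -/
theorem outerProduct_degree_trim {f : MvPolynomial σ K} {e : ℕ} (hf : f.IsHomogeneous e)
    (hp : Prime f) {m D : ℕ} (B : Matrix (Fin m) (Fin m) (MvPolynomial σ K))
    (hB : ∀ i j, (B i j).totalDegree ≤ D) (c w : Fin m → MvPolynomial σ K)
    (h : ∀ i j, B i j - c i * w j ∈ Ideal.span {f}) :
    ∃ (c' w' : Fin m → MvPolynomial σ K) (dc dw : ℕ), dc + dw ≤ D ∧
      (∀ i, (c' i).totalDegree ≤ dc) ∧ (∀ i, (w' i).totalDegree ≤ dw) ∧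
      ∀ i j, B i j - c' i * w' j ∈ Ideal.span {f} := by
  classical
  set I := Ideal.span {f} with hI
  have hIprime : I.IsPrime := (Ideal.span_singleton_prime hp.ne_zero).mpr hp
  rcases Nat.eq_zero_or_pos m with rfl | hm
  · exact ⟨c, w, 0, 0, by omega, fun i => Fin.elim0 i, fun i => Fin.elim0 i, fun i => Fin.elim0 i⟩
  haveI : Nonempty (Fin m) := ⟨⟨0, hm⟩⟩
  choose q hq using fun i => exists_minimal_rep I (c i)
  choose r hr using fun j => exists_minimal_rep I (w j)
  have hBqr : ∀ i j, B i j - q i * r j ∈ I := by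
    intro i j
    have h1 : c i * w j - q i * r j ∈ I := by
      have := I.add_mem (I.mul_mem_right (w j) (hq i).1) (I.mul_mem_left (q i) (hr j).1)
      convert this using 1
      ring
    have := I.add_mem (h i j) h1
    rwa [sub_add_sub_cancel] at this
  set dc := Finset.univ.sup fun i => (q i).totalDegree with hdc
  set dw := Finset.univ.sup fun j => (r j).totalDegree with hdw
  have hqdeg : ∀ i, (q i).totalDegree ≤ dc := fun i =>
    Finset.le_sup (f := fun i => (q i).totalDegree) (Finset.mem_univ i)
  have hrdeg : ∀ j, (r j).totalDegree ≤ dw := fun j =>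
    Finset.le_sup (f := fun j => (r j).totalDegree) (Finset.mem_univ j)
  by_cases hsum : dc + dw ≤ D
  · exact ⟨q, r, dc, dw, hsum, hqdeg, hrdeg, hBqr⟩
  rw [not_le] at hsum
  suffices hall : (∀ i, q i ∈ I) ∨ (∀ j, r j ∈ I) by
    refine ⟨0, 0, 0, 0, by omega, fun i => by simp, fun i => by simp, fun i j => ?_⟩
    simp only [Pi.zero_apply, mul_zero, sub_zero]
    have hqr : q i * r j ∈ I :=
      hall.elim (fun h' => I.mul_mem_right _ (h' i)) (fun h' => I.mul_mem_left _ (h' j))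
    have := I.add_mem (hBqr i j) hqr
    rwa [sub_add_cancel] at this
  have key : ∀ i j, homogeneousComponent dc (q i) ∈ I ∨ homogeneousComponent dw (r j) ∈ I := by
    intro i j
    have hc := homogeneousComponent_mem_span hf (hBqr i j) (dc + dw)
    rw [map_sub, homogeneousComponent_eq_zero _ _ (lt_of_le_of_lt (hB i j) hsum), zero_sub,
      homogeneousComponent_mul_of_totalDegree_le _ _ (hqdeg i) (hrdeg j), neg_mem_iff] at hc
    exact hIprime.mem_or_mem hc
  obtain ⟨i₀, -, hi₀⟩ := Finset.exists_mem_eq_sup Finset.univ Finset.univ_nonempty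
    fun i => (q i).totalDegree
  obtain ⟨j₀, -, hj₀⟩ := Finset.exists_mem_eq_sup Finset.univ Finset.univ_nonempty
    fun j => (r j).totalDegree
  by_cases hq' : ∀ i, homogeneousComponent dc (q i) ∈ I
  · exact Or.inl (all_mem_of_top_mem hp (fun i => (hq i).2) hqdeg ⟨i₀, hi₀.symm⟩ hq')
  · push Not at hq'
    obtain ⟨i₁, hi₁⟩ := hq'
    exact Or.inr (all_mem_of_top_mem hp (fun j => (hr j).2) hrdeg ⟨j₀, hj₀.symm⟩
      fun j => (key i₁ j).resolve_left hi₁)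

/-- The determinant of a matrix of affine polynomials has degree at most its size. [folklore] -/
theorem totalDegree_det_le_of_le_one {ι : Type*} [Fintype ι] [DecidableEq ι]
    (N : Matrix ι ι (MvPolynomial σ K)) (h : ∀ i j, (N i j).totalDegree ≤ 1) :
    N.det.totalDegree ≤ Fintype.card ι := by
  rw [Matrix.det_apply']
  refine totalDegree_finsetSum_le fun τ _ => ?_
  refine (totalDegree_mul _ _).trans ?_
  have h1 : (((Equiv.Perm.sign τ : ℤˣ) : ℤ) : MvPolynomial σ K).totalDegree = 0 := by
    rw [← map_intCast (C : K →+* MvPolynomial σ K), totalDegree_C]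
  rw [h1, zero_add]
  refine (totalDegree_finsetProd _ _).trans ?_
  calc ∑ i, (N (τ i) i).totalDegree ≤ ∑ _i : ι, 1 := Finset.sum_le_sum fun i _ => h _ _
    _ = Fintype.card ι := by simp

/-- Cofactors of an `m × m` matrix of affine polynomials have degree `≤ m - 1`. [folklore] -/
theorem totalDegree_adjugate_le {m : ℕ} (A : Matrix (Fin m) (Fin m) (MvPolynomial σ K))
    (hA : ∀ i j, (A i j).totalDegree ≤ 1) (i j : Fin m) :
    (A.adjugate i j).totalDegree ≤ m - 1 := by
  cases m with
  | zero => exact Fin.elim0 i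
  | succ k =>
    rw [Matrix.adjugate_fin_succ_eq_det_submatrix]
    refine (totalDegree_mul _ _).trans ?_
    have h1 : ((-1 : MvPolynomial σ K) ^ ((j : ℕ) + i)).totalDegree = 0 := by
      rw [show ((-1 : MvPolynomial σ K) ^ ((j : ℕ) + i)) = C ((-1) ^ ((j : ℕ) + i)) by simp,
        totalDegree_C]
    rw [h1, zero_add, Nat.add_sub_cancel]
    simpa [Fintype.card_fin] using
      totalDegree_det_le_of_le_one (A.submatrix j.succAbove i.succAbove) fun a b => hA _ _

/-! ### The two lines' degree-budget stubs, signatures verbatim — PROVED -/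

/-- `Lines/pic-not-cl.lean :: stub_degreeBudget_mod_homogeneous_prime`, PROVED. [folklore] -/
theorem stub_degreeBudget_mod_homogeneous_prime :
    ∀ (σ K : Type) [Field K] (f : MvPolynomial σ K) (e : ℕ), f.IsHomogeneous e → Prime f →
      ∀ (m D : ℕ) (B : Matrix (Fin m) (Fin m) (MvPolynomial σ K)),
        (∀ i j, (B i j).totalDegree ≤ D) →
        ∀ (c' w' : Fin m → MvPolynomial σ K), (∀ i j, B i j - c' i * w' j ∈ Ideal.span {f}) →
          ∃ (c w : Fin m → MvPolynomial σ K) (dc dw : ℕ), dc + dw ≤ D ∧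
            (∀ i, (c i).totalDegree ≤ dc) ∧ (∀ i, (w i).totalDegree ≤ dw) ∧
            ∀ i j, B i j - c i * w j ∈ Ideal.span {f} :=
  fun _ _ _ _ _ hf hp _ _ B hB c' w' h => outerProduct_degree_trim hf hp B hB c' w' h

/-- `Lines/nagata-multilinear-chart.lean :: stub_gradedOuterProductBudget`, PROVED. [folklore] -/
theorem stub_gradedOuterProductBudget :
    ∀ (K σ : Type) [Field K] (f : MvPolynomial σ K) (d : ℕ), f.IsHomogeneous d → Prime f →
      ∀ (m : ℕ) (A : Matrix (Fin m) (Fin m) (MvPolynomial σ K)), (∀ i j, (A i j).totalDegree ≤ 1) →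
        (∃ c₀ w₀ : Fin m → MvPolynomial σ K, ∀ i j, A.adjugate i j - c₀ i * w₀ j ∈ Ideal.span {f}) →
          ∃ (c w : Fin m → MvPolynomial σ K) (dc dw : ℕ), dc + dw ≤ m - 1 ∧
            (∀ i, (c i).totalDegree ≤ dc) ∧ (∀ i, (w i).totalDegree ≤ dw) ∧
            ∀ i j, A.adjugate i j - c i * w j ∈ Ideal.span {f} := by
  intro K σ _ f d hf hp m A hA hex
  obtain ⟨c₀, w₀, h⟩ := hex
  exact outerProduct_degree_trim hf hp A.adjugate (totalDegree_adjugate_le A hA) c₀ w₀ h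


end DegreeBudget

/-! ### Specialisation to `per_n` over `ℂ` -/

/-- `per_n` is prime for `n ≥ 1` (tree: `perPoly_irreducible`, vzG Thm 3.4). [folklore] -/
theorem perPoly_prime {n : ℕ} (hn : 1 ≤ n) : Prime (perPoly (Fin n) ℂ) := by
  haveI : Nonempty (Fin n) := ⟨⟨0, hn⟩⟩
  exact UniqueFactorizationMonoid.irreducible_iff_prime.mp perPoly_irreducible

/-- `(per_n)` is a prime ideal for `n ≥ 1`. [folklore] -/
theorem span_perPoly_isPrime {n : ℕ} (hn : 1 ≤ n) :
    (Ideal.span {perPoly (Fin n) ℂ}).IsPrime :=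
  (Ideal.span_singleton_prime (perPoly_prime hn).ne_zero).mpr (perPoly_prime hn)

/-- `(per_n)` is a homogeneous ideal: it contains the homogeneous components of its elements.
[folklore] -/
theorem homogeneousComponent_mem_span_perPoly {n : ℕ} {f : MvPolynomial (Fin n × Fin n) ℂ}
    (hf : f ∈ Ideal.span {perPoly (Fin n) ℂ}) (d : ℕ) :
    homogeneousComponent d f ∈ Ideal.span {perPoly (Fin n) ℂ} :=
  homogeneousComponent_mem_span
    (by simpa [Fintype.card_fin] using perPoly_isHomogeneous (n := Fin n) (k := ℂ)) hf d

/-- **Degree bookkeeping is automatic (per_n form).** If a matrix `B` with entries of degree `≤ D`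
factors as an outer product modulo `per_n` AT ALL (`n ≥ 1`), then it does so with `deg c + deg w ≤ D`.
[folklore] -/
theorem outerProduct_degree_automatic {n m D : ℕ} (hn : 1 ≤ n)
    (B : Matrix (Fin m) (Fin m) (MvPolynomial (Fin n × Fin n) ℂ)) (hB : ∀ i j, (B i j).totalDegree ≤ D)
    (c w : Fin m → MvPolynomial (Fin n × Fin n) ℂ)
    (h : ∀ i j, B i j - c i * w j ∈ Ideal.span {perPoly (Fin n) ℂ}) :
    ∃ (c' w' : Fin m → MvPolynomial (Fin n × Fin n) ℂ) (dc dw : ℕ), dc + dw ≤ D ∧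
      (∀ i, (c' i).totalDegree ≤ dc) ∧ (∀ i, (w' i).totalDegree ≤ dw) ∧
      ∀ i j, B i j - c' i * w' j ∈ Ideal.span {perPoly (Fin n) ℂ} :=
  outerProduct_degree_trim
    (by simpa [Fintype.card_fin] using perPoly_isHomogeneous (n := Fin n) (k := ℂ))
    (perPoly_prime hn) B hB c w h

/-- The crux with its degree bookkeeping DROPPED: only "`adj A` is an outer product modulo `per_n`". -/
def RankOneTrivialisationDegreeFree : Prop :=
  ∀ n : ℕ, 3 ≤ n → ∀ (m : ℕ) (A : Matrix (Fin m) (Fin m) (MvPolynomial (Fin n × Fin n) ℂ)),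
    IsAffineDetRepr (perPoly (Fin n) ℂ) A →
    ∃ (c w : Fin m → MvPolynomial (Fin n × Fin n) ℂ),
      ∀ i j, A.adjugate i j - c i * w j ∈ Ideal.span {perPoly (Fin n) ℂ}

/-- **The degree budget carries no load.** `RankOneTrivialisation` is EQUIVALENT to its degree-free
form: the clause `dc + dw ≤ m - 1` (tight at `Bpp`, section (b)) is recovered for free from any
factorisation by passing to minimal-degree representatives (`outerProduct_degree_automatic` with
`D = m - 1 ≥ deg (adj A)ᵢⱼ`).  Consequence for would-be counterexamples: a representation refutes the
crux iff its adjugate is not an outer product modulo `per_n` AT ALL, i.e. iff the invertible module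
`ker (A mod per_n)` is a non-trivial element of `Pic(ℂ[x]/(per_n))` — degrees never decide. [folklore] -/
theorem rankOneTrivialisation_iff_degreeFree :
    RankOneTrivialisation ↔ RankOneTrivialisationDegreeFree := by
  constructor
  · intro h n hn m A hA
    obtain ⟨c, w, _, _, -, -, -, hcw⟩ := h n hn m A hA
    exact ⟨c, w, hcw⟩
  · intro h n hn m A hA
    obtain ⟨c, w, hcw⟩ := h n hn m A hA
    exact outerProduct_degree_automatic (by omega) A.adjugate (totalDegree_adjugate_le A hA.1) c w hcw


/-- **Upgrade of (a): at `n = 2` the failure is not a degree artefact.** `adj A₂` is not an outer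
product modulo `per₂` AT ALL (any factorisation could be trimmed to `deg c + deg w ≤ 1` by
`outerProduct_degree_automatic`, which only needs `n ≥ 1`). In module language: the kernel of `A₂`
over `ℂ[x]/(per₂)` is the rank-one MCM module of the ruling of the quadric cone — a Weil divisor class
generating `Cl = ℤ`, not Cartier at the vertex. [folklore] -/
theorem A₂_adjugate_not_outerProduct :
    ¬ ∃ (c w : Fin 2 → MvPolynomial (Fin 2 × Fin 2) ℂ),
      ∀ i j, A₂.adjugate i j - c i * w j ∈ Ideal.span {perPoly (Fin 2) ℂ} := by
  rintro ⟨c, w, h⟩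
  obtain ⟨c', w', dc, dw, hsum, hc, hw, hmem⟩ :=
    outerProduct_degree_automatic (n := 2) one_le_two A₂.adjugate
      (totalDegree_adjugate_le A₂ isAffineDetRepr_A₂.1) c w h
  exact A₂_no_bounded_factorisation c' w' dc dw hsum hc hw hmem

/-- Hence also the DEGREE-FREE crux fails when `3 ≤ n` is weakened to `2 ≤ n`. [folklore] -/
theorem rankOneTrivialisationDegreeFree_false_from_two :
    ¬ ∀ n : ℕ, 2 ≤ n → ∀ (m : ℕ) (A : Matrix (Fin m) (Fin m) (MvPolynomial (Fin n × Fin n) ℂ)),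
      IsAffineDetRepr (perPoly (Fin n) ℂ) A →
      ∃ (c w : Fin m → MvPolynomial (Fin n × Fin n) ℂ),
        ∀ i j, A.adjugate i j - c i * w j ∈ Ideal.span {perPoly (Fin n) ℂ} := fun h =>
  A₂_adjugate_not_outerProduct (h 2 le_rfl 2 A₂ isAffineDetRepr_A₂)

/-! ## (e) Natural strengthenings "a UNIT cofactor" / "a UNIMODULAR column of cofactors" are FALSE -/

section UnitCofactor

/-- Cofactors in every column `j ≠ r` of a matrix whose row `r` vanishes are zero. [folklore] -/
theorem adjugate_eq_zero_of_row_eq_zero {R : Type*} [CommRing R] {m : ℕ}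
    (M : Matrix (Fin m) (Fin m) R) (r : Fin m) (hr : ∀ k, M r k = 0) (i j : Fin m) (hj : j ≠ r) :
    M.adjugate i j = 0 := by
  rw [Matrix.adjugate_apply]
  exact Matrix.det_eq_zero_of_row_eq_zero r fun k => by rw [Matrix.updateRow_ne hj.symm]; exact hr k

/-- The constant row operation `1 - E_{u₀ s}` (row `u₀ ↦ u₀ - s`). -/
def Pc : Matrix (Fin 7) (Fin 7) (MvPolynomial (Fin 3 × Fin 3) ℂ) :=
  !![1, 0, 0, 0, 0, 0, 0;
     -1, 1, 0, 0, 0, 0, 0;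
     0, 0, 1, 0, 0, 0, 0;
     0, 0, 0, 1, 0, 0, 0;
     0, 0, 0, 0, 1, 0, 0;
     0, 0, 0, 0, 0, 1, 0;
     0, 0, 0, 0, 0, 0, 1]

/-- The constant column operation `1 - E_{s v₂}` (column `v₂ ↦ v₂ - s`). -/
def Qc : Matrix (Fin 7) (Fin 7) (MvPolynomial (Fin 3 × Fin 3) ℂ) :=
  !![1, 0, 0, 0, 0, 0, -1;
     0, 1, 0, 0, 0, 0, 0;
     0, 0, 1, 0, 0, 0, 0;
     0, 0, 0, 1, 0, 0, 0;
     0, 0, 0, 0, 1, 0, 0;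
     0, 0, 0, 0, 0, 1, 0;
     0, 0, 0, 0, 0, 0, 1]

/-- `gA · Qc`. -/
def Bq : Matrix (Fin 7) (Fin 7) (MvPolynomial (Fin 3 × Fin 3) ℂ) :=
  !![0, X (0, 0), X (1, 0), X (2, 0), 0, 0, 0;
     0, 1, 0, 0, 0, X (2, 1), X (1, 1);
     0, 0, 1, 0, X (2, 1), 0, X (0, 1);
     0, 0, 0, 1, X (1, 1), X (0, 1), 0;
     X (0, 2), 0, 0, 0, 1, 0, -X (0, 2);
     X (1, 2), 0, 0, 0, 0, 1, -X (1, 2);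
     X (2, 2), 0, 0, 0, 0, 0, 1 - X (2, 2)]

/-- **The witness** `Bc = Pc · gA · Qc`: Grenet's matrix in a CONSTANT two-sided gauge
(`det Pc = det Qc = 1`), again a `7 × 7` affine determinantal representation of `per₃`. -/
def Bc : Matrix (Fin 7) (Fin 7) (MvPolynomial (Fin 3 × Fin 3) ℂ) :=
  !![0, X (0, 0), X (1, 0), X (2, 0), 0, 0, 0;
     0, 1 - X (0, 0), -X (1, 0), -X (2, 0), 0, X (2, 1), X (1, 1);
     0, 0, 1, 0, X (2, 1), 0, X (0, 1);
     0, 0, 0, 1, X (1, 1), X (0, 1), 0;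
     X (0, 2), 0, 0, 0, 1, 0, -X (0, 2);
     X (1, 2), 0, 0, 0, 0, 1, -X (1, 2);
     X (2, 2), 0, 0, 0, 0, 0, 1 - X (2, 2)]

theorem gA_mul_Qc : gA * Qc = Bq := by
  refine Matrix.ext fun i j => ?_
  fin_cases i <;> fin_cases j <;> simp [gA, Qc, Bq, Matrix.mul_apply, Fin.sum_univ_seven]
  all_goals ring

theorem Pc_mul_Bq : Pc * Bq = Bc := by
  refine Matrix.ext fun i j => ?_
  fin_cases i <;> fin_cases j <;> simp [Pc, Bq, Bc, Matrix.mul_apply, Fin.sum_univ_seven]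
  all_goals ring

theorem det_Pc : Pc.det = 1 := by
  rw [Matrix.det_of_lowerTriangular Pc (by
    intro i j hij; fin_cases i <;> fin_cases j <;> first | exact absurd hij (by decide) | simp [Pc]),
    Fin.prod_univ_seven]
  simp [Pc]

theorem det_Qc : Qc.det = 1 := by
  rw [Matrix.det_of_upperTriangular (M := Qc) (by
    intro i j hij; fin_cases i <;> fin_cases j <;> first | exact absurd hij (by decide) | simp [Qc]),
    Fin.prod_univ_seven]
  simp [Qc]

theorem det_Bc : Bc.det = perPoly (Fin 3) ℂ := by
  rw [← Pc_mul_Bq, ← gA_mul_Qc, Matrix.det_mul, Matrix.det_mul, det_Pc, det_Qc, det_gA, one_mul,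
    mul_one]

/-- `Bc` is an affine determinantal representation of `per₃` (size `7`). [folklore] -/
theorem isAffineDetRepr_Bc : IsAffineDetRepr (perPoly (Fin 3) ℂ) Bc := by
  refine ⟨fun i j => ?_, det_Bc⟩
  fin_cases i <;> fin_cases j <;> simp [Bc, totalDegree_X, totalDegree_neg] <;>
    exact (totalDegree_sub _ _).trans (max_le (by simp) (by simp [totalDegree_X]))

/-- The point `p₁ ∈ V(per₃)`: `x₀₀ = x₂₂ = 1`, all other entries `0`. -/
def p₁ : Fin 3 × Fin 3 → ℂ := fun rc => if rc = (0, 0) ∨ rc = (2, 2) then 1 else 0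

theorem eval_zero_perPoly₃ : eval (fun _ => (0 : ℂ)) (perPoly (Fin 3) ℂ) = 0 := by
  rw [perPoly_three_eq]; simp [per₃]

theorem eval_p₁_perPoly₃ : eval p₁ (perPoly (Fin 3) ℂ) = 0 := by
  rw [perPoly_three_eq]; simp [per₃, p₁]

/-- At the origin the row `s` of `Bc` vanishes. -/
theorem eval_zero_Bc_row_s (k : Fin 7) : eval (fun _ => (0 : ℂ)) (Bc 0 k) = 0 := by
  fin_cases k <;> simp [Bc]

/-- At `p₁` the row `u₀` of `Bc` vanishes. -/
theorem eval_p₁_Bc_row_u₀ (k : Fin 7) : eval p₁ (Bc 1 k) = 0 := by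
  fin_cases k <;> simp [Bc, p₁]

/-- **Every column of `adj Bc` dies at some point of `V(per₃)`**: column `s` at `p₁` (where row `u₀`
of `Bc` vanishes), every other column at the origin (where row `s` vanishes). [folklore] -/
theorem column_adjugate_Bc_vanishes (j : Fin 7) :
    ∃ p : Fin 3 × Fin 3 → ℂ, eval p (perPoly (Fin 3) ℂ) = 0 ∧ ∀ i, eval p (Bc.adjugate i j) = 0 := by
  have key : ∀ (p : Fin 3 × Fin 3 → ℂ) (r : Fin 7), (∀ k, eval p (Bc r k) = 0) → j ≠ r →
      ∀ i, eval p (Bc.adjugate i j) = 0 := by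
    intro p r hr hjr i
    have h := RingHom.map_adjugate (eval p) Bc
    rw [RingHom.mapMatrix_apply, RingHom.mapMatrix_apply] at h
    have hij : eval p (Bc.adjugate i j) = (Bc.map (eval p)).adjugate i j := by
      simpa [Matrix.map_apply] using congr_fun (congr_fun h i) j
    rw [hij]
    exact adjugate_eq_zero_of_row_eq_zero _ r (fun k => by simpa [Matrix.map_apply] using hr k) i j hjr
  by_cases hj : j = 0
  · exact ⟨p₁, eval_p₁_perPoly₃, key p₁ 1 eval_p₁_Bc_row_u₀ (by rw [hj]; decide)⟩
  · exact ⟨fun _ => 0, eval_zero_perPoly₃, key _ 0 eval_zero_Bc_row_s hj⟩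

/-- Strengthening 1: "some column of cofactors is unimodular modulo `per_n`" (a STANDARD cyclic
vector `u = e_j` in the language of card invertible-cokernel-pic; true for Grenet's matrices, whose
cofactor `(adj gA)_{ss}` is `1`). -/
def RankOneTrivialisationUnimodularColumn : Prop :=
  ∀ n : ℕ, 3 ≤ n → ∀ (m : ℕ) (A : Matrix (Fin m) (Fin m) (MvPolynomial (Fin n × Fin n) ℂ)),
    IsAffineDetRepr (perPoly (Fin n) ℂ) A →
    ∃ j : Fin m, (1 : MvPolynomial (Fin n × Fin n) ℂ) ∈
      Ideal.span (insert (perPoly (Fin n) ℂ) (Set.range fun i => A.adjugate i j))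

/-- Strengthening 2: "some cofactor is a non-zero constant modulo `per_n`" (again true for Grenet's
matrices and for the twisted `Bpp`: `(adj gA)_{ss} = (adj Bpp)_{ss} = 1`). -/
def RankOneTrivialisationUnitCofactor : Prop :=
  ∀ n : ℕ, 3 ≤ n → ∀ (m : ℕ) (A : Matrix (Fin m) (Fin m) (MvPolynomial (Fin n × Fin n) ℂ)),
    IsAffineDetRepr (perPoly (Fin n) ℂ) A →
    ∃ (i j : Fin m) (κ : ℂ), κ ≠ 0 ∧ A.adjugate i j - C κ ∈ Ideal.span {perPoly (Fin n) ℂ}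

/-- **Strengthening 1 is false**: for `Bc = Pc·gA·Qc` no column of cofactors is unimodular modulo
`per₃` — each column dies at a point of the hypersurface, so the ideal it generates with `per₃` is
proper. A CONSTANT gauge already destroys Grenet's unit cofactor: the trivialising sections `c, w` of
the crux are genuinely polynomial in every entry, and vzG's "unit content" is a statement about all
`m²` cofactors jointly, never about one column (or row, by symmetry). [folklore] -/
theorem not_unimodularColumn : ¬ RankOneTrivialisationUnimodularColumn := by
  intro h
  obtain ⟨j, hj⟩ := h 3 le_rfl 7 Bc isAffineDetRepr_Bc
  obtain ⟨p, hper, hp⟩ := column_adjugate_Bc_vanishes j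
  have hle : Ideal.span (insert (perPoly (Fin 3) ℂ) (Set.range fun i => Bc.adjugate i j)) ≤
      RingHom.ker (eval p) := by
    rw [Ideal.span_le]
    rintro f (rfl | ⟨i, rfl⟩)
    · exact hper
    · exact hp i
  have h1 := hle hj
  rw [RingHom.mem_ker, map_one] at h1
  exact one_ne_zero h1

/-- Strengthening 2 implies strengthening 1. [folklore] -/
theorem unimodularColumn_of_unitCofactor (h : RankOneTrivialisationUnitCofactor) :
    RankOneTrivialisationUnimodularColumn := by
  intro n hn m A hA
  obtain ⟨i, j, κ, hκ, hmem⟩ := h n hn m A hA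
  refine ⟨j, ?_⟩
  set J := Ideal.span (insert (perPoly (Fin n) ℂ) (Set.range fun i => A.adjugate i j))
  have h1 : A.adjugate i j ∈ J := Ideal.subset_span (Set.mem_insert_of_mem _ ⟨i, rfl⟩)
  have h2 : A.adjugate i j - C κ ∈ J :=
    Ideal.span_mono (Set.singleton_subset_iff.2 (Set.mem_insert _ _)) hmem
  have h3 : C κ ∈ J := by simpa using J.sub_mem h1 h2
  have h4 := J.mul_mem_left (C κ⁻¹) h3
  rwa [← C_mul, inv_mul_cancel₀ hκ, C_1] at h4

/-- **Strengthening 2 is false** (at `Bc`). [folklore] -/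
theorem not_unitCofactor : ¬ RankOneTrivialisationUnitCofactor := fun h =>
  not_unimodularColumn (unimodularColumn_of_unitCofactor h)

/-! ### Rows too: no unimodular ROW of cofactors (so neither `c` nor `w` can carry a unit entry) -/

/-- Cofactors in every row `i ≠ s` of a matrix whose column `s` vanishes are zero. [folklore] -/
theorem adjugate_eq_zero_of_col_eq_zero {R : Type*} [CommRing R] {m : ℕ}
    (M : Matrix (Fin m) (Fin m) R) (s : Fin m) (hs : ∀ k, M k s = 0) (i j : Fin m) (hi : i ≠ s) :
    M.adjugate i j = 0 := by
  rw [Matrix.adjugate_apply]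
  refine Matrix.det_eq_zero_of_column_eq_zero s fun k => ?_
  by_cases hk : k = j
  · subst hk
    simp [Matrix.updateRow_self, hi.symm]
  · rw [Matrix.updateRow_ne hk]
    exact hs k

/-- At the origin the column `s` of `Bc` vanishes. -/
theorem eval_zero_Bc_col_s (k : Fin 7) : eval (fun _ => (0 : ℂ)) (Bc k 0) = 0 := by
  fin_cases k <;> simp [Bc]

/-- At `p₁` the column `v₂` of `Bc` vanishes. -/
theorem eval_p₁_Bc_col_v₂ (k : Fin 7) : eval p₁ (Bc k 6) = 0 := by
  fin_cases k <;> simp [Bc, p₁]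

/-- **Every row of `adj Bc` dies at some point of `V(per₃)`**: row `s` at `p₁` (zero column `v₂`),
every other row at the origin (zero column `s`). [folklore] -/
theorem row_adjugate_Bc_vanishes (i : Fin 7) :
    ∃ p : Fin 3 × Fin 3 → ℂ, eval p (perPoly (Fin 3) ℂ) = 0 ∧ ∀ j, eval p (Bc.adjugate i j) = 0 := by
  have key : ∀ (p : Fin 3 × Fin 3 → ℂ) (s : Fin 7), (∀ k, eval p (Bc k s) = 0) → i ≠ s →
      ∀ j, eval p (Bc.adjugate i j) = 0 := by
    intro p s hs his j
    have h := RingHom.map_adjugate (eval p) Bc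
    rw [RingHom.mapMatrix_apply, RingHom.mapMatrix_apply] at h
    have hij : eval p (Bc.adjugate i j) = (Bc.map (eval p)).adjugate i j := by
      simpa [Matrix.map_apply] using congr_fun (congr_fun h i) j
    rw [hij]
    exact adjugate_eq_zero_of_col_eq_zero _ s (fun k => by simpa [Matrix.map_apply] using hs k) i j his
  by_cases hi : i = 0
  · exact ⟨p₁, eval_p₁_perPoly₃, key p₁ 6 eval_p₁_Bc_col_v₂ (by rw [hi]; decide)⟩
  · exact ⟨fun _ => 0, eval_zero_perPoly₃, key _ 0 eval_zero_Bc_col_s hi⟩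

/-- Strengthening 1ᵀ: "some ROW of cofactors is unimodular modulo `per_n`" (a unit entry in `w`
rather than in `c`). -/
def RankOneTrivialisationUnimodularRow : Prop :=
  ∀ n : ℕ, 3 ≤ n → ∀ (m : ℕ) (A : Matrix (Fin m) (Fin m) (MvPolynomial (Fin n × Fin n) ℂ)),
    IsAffineDetRepr (perPoly (Fin n) ℂ) A →
    ∃ i : Fin m, (1 : MvPolynomial (Fin n × Fin n) ℂ) ∈
      Ideal.span (insert (perPoly (Fin n) ℂ) (Set.range fun j => A.adjugate i j))

/-- **Strengthening 1ᵀ is false** at the same witness `Bc` (its columns `s` / `v₂` vanish at `0` / `p₁`):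
by the symmetry `c ↔ w` neither factor of a trivialisation can be normalised to a unit entry. [folklore] -/
theorem not_unimodularRow : ¬ RankOneTrivialisationUnimodularRow := by
  intro h
  obtain ⟨i, hi⟩ := h 3 le_rfl 7 Bc isAffineDetRepr_Bc
  obtain ⟨p, hper, hp⟩ := row_adjugate_Bc_vanishes i
  have hle : Ideal.span (insert (perPoly (Fin 3) ℂ) (Set.range fun j => Bc.adjugate i j)) ≤
      RingHom.ker (eval p) := by
    rw [Ideal.span_le]
    rintro f (rfl | ⟨j, rfl⟩)
    · exact hper
    · exact hp j
  have h1 := hle hi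
  rw [RingHom.mem_ker, map_one] at h1
  exact one_ne_zero h1

/-! ### Why these strengthenings are natural: Grenet's matrix HAS a unit cofactor -/

/-- `gA` with row `s` replaced by `e_sᵀ`. -/
def U₇ : Matrix (Fin 7) (Fin 7) (MvPolynomial (Fin 3 × Fin 3) ℂ) :=
  !![1, 0, 0, 0, 0, 0, 0;
     0, 1, 0, 0, 0, X (2, 1), X (1, 1);
     0, 0, 1, 0, X (2, 1), 0, X (0, 1);
     0, 0, 0, 1, X (1, 1), X (0, 1), 0;
     X (0, 2), 0, 0, 0, 1, 0, 0;
     X (1, 2), 0, 0, 0, 0, 1, 0;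
     X (2, 2), 0, 0, 0, 0, 0, 1]

/-- Row operations `v_i ↦ v_i - x_{i2}·s`. -/
def L₇ : Matrix (Fin 7) (Fin 7) (MvPolynomial (Fin 3 × Fin 3) ℂ) :=
  !![1, 0, 0, 0, 0, 0, 0;
     0, 1, 0, 0, 0, 0, 0;
     0, 0, 1, 0, 0, 0, 0;
     0, 0, 0, 1, 0, 0, 0;
     -X (0, 2), 0, 0, 0, 1, 0, 0;
     -X (1, 2), 0, 0, 0, 0, 1, 0;
     -X (2, 2), 0, 0, 0, 0, 0, 1]

/-- Upper unitriangular. -/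
def V₇ : Matrix (Fin 7) (Fin 7) (MvPolynomial (Fin 3 × Fin 3) ℂ) :=
  !![1, 0, 0, 0, 0, 0, 0;
     0, 1, 0, 0, 0, X (2, 1), X (1, 1);
     0, 0, 1, 0, X (2, 1), 0, X (0, 1);
     0, 0, 0, 1, X (1, 1), X (0, 1), 0;
     0, 0, 0, 0, 1, 0, 0;
     0, 0, 0, 0, 0, 1, 0;
     0, 0, 0, 0, 0, 0, 1]

theorem gA_updateRow : gA.updateRow 0 (Pi.single 0 1) = U₇ := by
  refine Matrix.ext fun i j => ?_
  fin_cases i <;> fin_cases j <;> simp [gA, U₇, Matrix.updateRow_apply]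

theorem L₇_mul_U₇ : L₇ * U₇ = V₇ := by
  refine Matrix.ext fun i j => ?_
  fin_cases i <;> fin_cases j <;> simp [L₇, U₇, V₇, Matrix.mul_apply, Fin.sum_univ_seven]

theorem det_L₇ : L₇.det = 1 := by
  rw [Matrix.det_of_lowerTriangular L₇ (by
    intro i j hij; fin_cases i <;> fin_cases j <;> first | exact absurd hij (by decide) | simp [L₇]),
    Fin.prod_univ_seven]
  simp [L₇]

theorem det_V₇ : V₇.det = 1 := by
  rw [Matrix.det_of_upperTriangular (M := V₇) (by
    intro i j hij; fin_cases i <;> fin_cases j <;> first | exact absurd hij (by decide) | simp [V₇]),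
    Fin.prod_univ_seven]
  simp [V₇]

/-- **Grenet's matrix has the unit cofactor `(adj gA)_{ss} = 1`** (the complementary minor is
unitriangular after clearing column `s`), so `gA` satisfies both strengthenings — they fail only
after the constant gauge `Pc · gA · Qc`. [folklore] -/
theorem adjugate_gA_ss : gA.adjugate 0 0 = 1 := by
  rw [Matrix.adjugate_apply, gA_updateRow]
  have h := congrArg Matrix.det L₇_mul_U₇
  rwa [Matrix.det_mul, det_L₇, det_V₇, one_mul] at h

end UnitCofactor


end Summit.ValiantsHypothesis.ValiantsHypothesis.Cruxes.RankOneTrivialisation.Disproof
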